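import Summits.Ventures.Crystal3D.Theorems.StickyWulffConstantCoaxialWallLawLayered
import Summits.Ventures.Crystal3D.Theorems.StickyWulffConstantCoaxialWallLawTwoSidedSlots
import HarnessLib

/-!
# Located in-plane run ends WITH PREDECESSOR (both grains, all fillings): the thinning trick

HONEST FRAMING. Part of the venture `Summits/Ventures/Crystal3D` (cell `crystal3d-full`), helper
`--supports` the crux `CoaxialWallLaw` (stmt-Ventures-19481, `route-Ventures-StickyWulffConstant`),
REGISTERED line `WallLedgerF` (planner cf-p1 gen 16), open stub `stub_coaxialTwoSlabAdhesion`.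
RUNG CREDIT ONLY (third brick of the LAMINAR rung, after `…LaminarLocal` and `…HexagonRigidity`); F-C1 not moved.

The located run-end counts `…Layered.card_inPlane_runEnds_ge_coaxial` (bottom grain, rows followed upwards) and
`…TwoSidedSlots.card_inPlane_runEnds_top_ge_coaxial` (top grain, rows followed downwards) record an end as a ball
`e ∈ X` on the grain, off the other grain, with VACANT SUCCESSOR `e + d ∉ X`, in the payer window.  The laminar end
law (`…HexagonRigidity`) needs the PREDECESSOR `e − d ∈ X` as well (six in-layer contacts containing `e − d` would
contain `e + d`).  Every end produced by the forward-ray injection has one (the run is rooted in a complete sample),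
but the landed statements forgot it.  Instead of re-proving the four located counts we THIN the filling:

  `X⁻ := {x ∈ X : x − d ∈ X} ∪ P₁ ∪ P₂ ⊆ X`

is again a unit-separated filling of the same cell with the same complete samples, so the landed counts apply to
`X⁻`; an end `e` of `X⁻` has `e + d ∉ X` (else `e + d ∈ X⁻`), and `e − d ∈ X` unless `e` is a sample ball — then
`e − d` is a lattice point of the sample's slab one unit away, hence a sample ball too, except on the lateral rim
shell (`≤ 6(R₀ + 2)(6ρ − 3)` balls, `card_rim_window_le`).

* **`card_inPlane_runEndsPred_ge_coaxial`** — bottom grain, signed in-plane class `d = A₁ u = L(ε(i u₁ + j u₂))`,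
  `⟪d, e₃⟫ ≥ 0`: `#{e ∈ X ∩ Λ₁ ∖ Λ₂ : e + d ∉ X, e − d ∈ X, −R₀ − 2 ≤ e₂ ≤ h + R₀ + 2} ≥
  (2/3)√2|⟪d, e₃⟫| πρ² − (12√2π + 120 R₀)ρ` (every co-axial pair, every filling).
* **`card_inPlane_runEndsPred_top_ge_coaxial`** — top grain, `d = A₂ u`, `⟪d, e₃⟫ ≤ 0`: the same for
  `e ∈ X ∩ Λ₂ ∖ Λ₁`.

WHAT THIS IS NOT: no deficiency is claimed here; F-C1 not moved.
-/

noncomputable section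

namespace Summit.Ventures.Crystal3D.Theorems

open Summit.Ventures.Crystal3D Finset
open Literature.MathematicalPhysics.StatisticalMechanics (fccStacking barlowStacking IsHaggSeq
  triangularVec₁ triangularVec₂)
open scoped InnerProductSpace

open scoped Classical in
/-- **Located in-plane run ends of the bottom grain WITH PREDECESSOR, co-axial pair.**  See the module
docstring. -/
theorem card_inPlane_runEndsPred_ge_coaxial
    (A₁ : EuclideanSpace ℝ (Fin 3) ≃ₗᵢ[ℝ] EuclideanSpace ℝ (Fin 3)) (t₁ : EuclideanSpace ℝ (Fin 3))
    (A₂ : EuclideanSpace ℝ (Fin 3) ≃ₗᵢ[ℝ] EuclideanSpace ℝ (Fin 3)) (t₂ : EuclideanSpace ℝ (Fin 3))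
    (L : EuclideanSpace ℝ (Fin 3) ≃ₗᵢ[ℝ] EuclideanSpace ℝ (Fin 3)) (s₁ s₂ : EuclideanSpace ℝ (Fin 3))
    {σ σ' : ℤ → ℤ} (hσ : IsHaggSeq σ) (hσ' : IsHaggSeq σ')
    (hsub₁ : (fun p => A₁ p + t₁) '' fccStacking 1 (Real.sqrt (2 / 3)) ⊆
      (fun p => L p + s₁) '' barlowStacking 1 (Real.sqrt (2 / 3)) σ)
    (hsub₂ : (fun p => A₂ p + t₂) '' fccStacking 1 (Real.sqrt (2 / 3)) ⊆
      (fun p => L p + s₂) '' barlowStacking 1 (Real.sqrt (2 / 3)) σ')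
    (hne : (fun p => A₁ p + t₁) '' fccStacking 1 (Real.sqrt (2 / 3)) ≠
      (fun p => A₂ p + t₂) '' fccStacking 1 (Real.sqrt (2 / 3)))
    (X P₁ P₂ : Finset (EuclideanSpace ℝ (Fin 3))) (R₀ h ρ : ℝ) (hR₀ : 10 ≤ R₀) (hρ : R₀ ≤ ρ)
    (hX : ∀ p ∈ X, ∀ q ∈ X, p ≠ q → 1 ≤ dist p q)
    (hcell : ∀ p ∈ X, -(2 * R₀) ≤ p 2 ∧ p 2 ≤ h + 2 * R₀ ∧ p 0 ^ 2 + p 1 ^ 2 ≤ ρ ^ 2)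
    (hP₁X : P₁ ⊆ X) (hP₂X : P₂ ⊆ X)
    (hP₁ : ∀ p, p ∈ P₁ ↔ (p ∈ (fun q => A₁ q + t₁) '' fccStacking 1 (Real.sqrt (2 / 3)) ∧
      -(2 * R₀) ≤ p 2 ∧ p 2 ≤ -R₀ ∧ p 0 ^ 2 + p 1 ^ 2 ≤ ρ ^ 2))
    (hP₂ : ∀ p, p ∈ P₂ ↔ (p ∈ (fun q => A₂ q + t₂) '' fccStacking 1 (Real.sqrt (2 / 3)) ∧
      h + R₀ ≤ p 2 ∧ p 2 ≤ h + 2 * R₀ ∧ p 0 ^ 2 + p 1 ^ 2 ≤ ρ ^ 2))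
    {u : EuclideanSpace ℝ (Fin 3)} (hu : u ∈ fccSlots)
    (hup : 0 ≤ ⟪A₁ u, EuclideanSpace.single (2 : Fin 3) (1 : ℝ)⟫_ℝ)
    {ε : ℝ} (hε : ε = 1 ∨ ε = -1) (i j : ℤ)
    (hAu : A₁ u = L (ε • ((i : ℝ) • triangularVec₁ (1 : ℝ) + (j : ℝ) • triangularVec₂ 1))) :
    2 / 3 * Real.sqrt 2 * |⟪A₁ u, EuclideanSpace.single (2 : Fin 3) (1 : ℝ)⟫_ℝ| * Real.pi * ρ ^ 2 -
        (12 * Real.sqrt 2 * Real.pi + 120 * R₀) * ρ ≤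
      ((X.filter fun e => e ∈ (fun q => A₁ q + t₁) '' fccStacking 1 (Real.sqrt (2 / 3)) ∧
        e ∉ (fun q => A₂ q + t₂) '' fccStacking 1 (Real.sqrt (2 / 3)) ∧
        e + A₁ u ∉ X ∧ e - A₁ u ∈ X ∧ -R₀ - 2 ≤ e 2 ∧ e 2 ≤ h + R₀ + 2).card : ℝ) := by
  set e₃ : EuclideanSpace ℝ (Fin 3) := EuclideanSpace.single (2 : Fin 3) (1 : ℝ) with he₃
  set Λ₁ := (fun q => A₁ q + t₁) '' fccStacking 1 (Real.sqrt (2 / 3)) with hΛ₁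
  set Λ₂ := (fun q => A₂ q + t₂) '' fccStacking 1 (Real.sqrt (2 / 3)) with hΛ₂
  set d : EuclideanSpace ℝ (Fin 3) := A₁ u with hd
  have hρ2 : (2 : ℝ) ≤ ρ := by linarith
  have huΛ : u ∈ fccStacking 1 (Real.sqrt (2 / 3)) := mem_fcc_of_mem_fccSlots hu
  have hd1 : ‖d‖ = 1 := by rw [hd, LinearIsometryEquiv.norm_map, norm_eq_one_of_mem_fccSlots hu]
  have hd2 : d 2 = ⟪A₁ u, e₃⟫_ℝ := apply_two_eq_inner_e₃ _
  have hd2le : d 2 ≤ 1 := by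
    have := abs_inner_slot_le_one A₁ hu
    rw [hd2]; exact (le_abs_self _).trans this
  have hd2nn : 0 ≤ d 2 := by rw [hd2]; exact hup
  -- the thinned filling
  set X' : Finset (EuclideanSpace ℝ (Fin 3)) := X.filter fun x => x - d ∈ X ∨ x ∈ P₁ ∨ x ∈ P₂ with hX'
  have hX'X : X' ⊆ X := filter_subset _ _
  have hX'sep : ∀ p ∈ X', ∀ q ∈ X', p ≠ q → 1 ≤ dist p q :=
    fun p hp q hq hpq => hX p (hX'X hp) q (hX'X hq) hpq
  have hcell' : ∀ p ∈ X', -(2 * R₀) ≤ p 2 ∧ p 2 ≤ h + 2 * R₀ ∧ p 0 ^ 2 + p 1 ^ 2 ≤ ρ ^ 2 :=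
    fun p hp => hcell p (hX'X hp)
  have hP₁X' : P₁ ⊆ X' := fun p hp => mem_filter.2 ⟨hP₁X hp, Or.inr (Or.inl hp)⟩
  have hP₂X' : P₂ ⊆ X' := fun p hp => mem_filter.2 ⟨hP₂X hp, Or.inr (Or.inr hp)⟩
  have hbase := card_inPlane_runEnds_ge_coaxial A₁ t₁ A₂ t₂ L s₁ s₂ hσ hσ' hsub₁ hsub₂ hne X' P₁ P₂ R₀ h ρ hR₀ hρ
    hX'sep hcell' hP₁X' hP₂X' hP₁ hP₂ hu hup hε i j hAu
  -- ends of the thinned filling are ends of `X` with predecessor, up to the lower rim shell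
  set ENDS := X.filter fun e => e ∈ Λ₁ ∧ e ∉ Λ₂ ∧ e + d ∉ X ∧ e - d ∈ X ∧ -R₀ - 2 ≤ e 2 ∧ e 2 ≤ h + R₀ + 2
    with hENDS
  set RIM := X.filter fun x => -(2 * R₀) ≤ x 2 ∧ x 2 ≤ -R₀ ∧ (ρ - 1) ^ 2 < x 0 ^ 2 + x 1 ^ 2 ∧
    x 0 ^ 2 + x 1 ^ 2 ≤ ρ ^ 2 with hRIM
  have hsplit : (X'.filter fun e => e ∈ Λ₁ ∧ e ∉ Λ₂ ∧ e + d ∉ X' ∧ -R₀ - 2 ≤ e 2 ∧ e 2 ≤ h + R₀ + 2) ⊆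
      ENDS ∪ RIM := by
    intro e he
    rw [mem_filter] at he
    obtain ⟨heX', heΛ₁, heΛ₂, hed, hlo, hhi⟩ := he
    have heX : e ∈ X := hX'X heX'
    have hedX : e + d ∉ X := by
      intro h'
      exact hed (mem_filter.2 ⟨h', Or.inl (by rw [add_sub_cancel_right]; exact heX)⟩)
    rcases (mem_filter.1 heX').2 with hpred | heP₁ | heP₂
    · exact mem_union_left _ (mem_filter.2 ⟨heX, heΛ₁, heΛ₂, hedX, hpred, hlo, hhi⟩)
    · -- a sample ball: its predecessor is a sample ball unless `e` is on the rim
      obtain ⟨-, he1, he2, helat⟩ := (hP₁ e).1 heP₁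
      by_cases hr : e 0 ^ 2 + e 1 ^ 2 ≤ (ρ - 1) ^ 2
      · refine mem_union_left _ (mem_filter.2 ⟨heX, heΛ₁, heΛ₂, hedX, ?_, hlo, hhi⟩)
        have hlat' : (e - d) 0 ^ 2 + (e - d) 1 ^ 2 ≤ ρ ^ 2 := by
          have := lateral_sq_le_of_dist_le_one (y := e - d) (q := e) (r := ρ - 1) (by linarith) hr
            (by rw [dist_eq_norm, sub_sub_cancel_left, norm_neg, hd1])
          rwa [sub_add_cancel] at this
        have h2' : (e - d) 2 = e 2 - d 2 := by simp
        have hmem : e - d ∈ Λ₁ := movedFcc_sub_site_mem A₁ t₁ heΛ₁ huΛ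
        exact hP₁X ((hP₁ _).2 ⟨hmem, by rw [h2']; linarith, by rw [h2']; linarith, hlat'⟩)
      · push Not at hr
        exact mem_union_right _ (mem_filter.2 ⟨heX, he1, he2, hr, helat⟩)
    · exact absurd ((hP₂ e).1 heP₂).1 heΛ₂
  have hRIM_le : (RIM.card : ℝ) ≤ 6 * (R₀ + 2) * (6 * ρ - 3) := by
    have h1 := card_rim_window_le X (-(2 * R₀)) (-R₀) ρ (by linarith) hρ2 hX RIM
      (filter_subset _ _) (fun p hp => (mem_filter.1 hp).2)
    have e : -R₀ - -(2 * R₀) + 2 = R₀ + 2 := by ring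
    rwa [e] at h1
  have hcard : (X'.filter fun e => e ∈ Λ₁ ∧ e ∉ Λ₂ ∧ e + d ∉ X' ∧ -R₀ - 2 ≤ e 2 ∧ e 2 ≤ h + R₀ + 2).card ≤
      ENDS.card + RIM.card := (card_le_card hsplit).trans (card_union_le _ _)
  have hcard' : (((X'.filter fun e => e ∈ Λ₁ ∧ e ∉ Λ₂ ∧ e + d ∉ X' ∧ -R₀ - 2 ≤ e 2 ∧
      e 2 ≤ h + R₀ + 2).card : ℕ) : ℝ) ≤ (ENDS.card : ℝ) + (RIM.card : ℝ) := by exact_mod_cast hcard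
  have hρ0 : (0 : ℝ) ≤ ρ := by linarith
  have hrim : 6 * (R₀ + 2) * (6 * ρ - 3) ≤ 48 * R₀ * ρ := by nlinarith
  have e120 : (12 * Real.sqrt 2 * Real.pi + 120 * R₀) * ρ =
      (12 * Real.sqrt 2 * Real.pi + 72 * R₀) * ρ + 48 * R₀ * ρ := by ring
  rw [e120]
  linarith

open scoped Classical in
/-- **Located in-plane run ends of the TOP grain WITH PREDECESSOR, co-axial pair** (rows followed downwards
along a non-ascending slot `d = A₂ u`).  See the module docstring. -/
theorem card_inPlane_runEndsPred_top_ge_coaxial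
    (A₁ : EuclideanSpace ℝ (Fin 3) ≃ₗᵢ[ℝ] EuclideanSpace ℝ (Fin 3)) (t₁ : EuclideanSpace ℝ (Fin 3))
    (A₂ : EuclideanSpace ℝ (Fin 3) ≃ₗᵢ[ℝ] EuclideanSpace ℝ (Fin 3)) (t₂ : EuclideanSpace ℝ (Fin 3))
    (L : EuclideanSpace ℝ (Fin 3) ≃ₗᵢ[ℝ] EuclideanSpace ℝ (Fin 3)) (s₁ s₂ : EuclideanSpace ℝ (Fin 3))
    {σ σ' : ℤ → ℤ} (hσ : IsHaggSeq σ) (hσ' : IsHaggSeq σ')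
    (hsub₁ : (fun p => A₁ p + t₁) '' fccStacking 1 (Real.sqrt (2 / 3)) ⊆
      (fun p => L p + s₁) '' barlowStacking 1 (Real.sqrt (2 / 3)) σ)
    (hsub₂ : (fun p => A₂ p + t₂) '' fccStacking 1 (Real.sqrt (2 / 3)) ⊆
      (fun p => L p + s₂) '' barlowStacking 1 (Real.sqrt (2 / 3)) σ')
    (hne : (fun p => A₁ p + t₁) '' fccStacking 1 (Real.sqrt (2 / 3)) ≠
      (fun p => A₂ p + t₂) '' fccStacking 1 (Real.sqrt (2 / 3)))
    (X P₁ P₂ : Finset (EuclideanSpace ℝ (Fin 3))) (R₀ h ρ : ℝ) (hR₀ : 10 ≤ R₀) (hρ : R₀ ≤ ρ)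
    (hX : ∀ p ∈ X, ∀ q ∈ X, p ≠ q → 1 ≤ dist p q)
    (hcell : ∀ p ∈ X, -(2 * R₀) ≤ p 2 ∧ p 2 ≤ h + 2 * R₀ ∧ p 0 ^ 2 + p 1 ^ 2 ≤ ρ ^ 2)
    (hP₁X : P₁ ⊆ X) (hP₂X : P₂ ⊆ X)
    (hP₁ : ∀ p, p ∈ P₁ ↔ (p ∈ (fun q => A₁ q + t₁) '' fccStacking 1 (Real.sqrt (2 / 3)) ∧
      -(2 * R₀) ≤ p 2 ∧ p 2 ≤ -R₀ ∧ p 0 ^ 2 + p 1 ^ 2 ≤ ρ ^ 2))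
    (hP₂ : ∀ p, p ∈ P₂ ↔ (p ∈ (fun q => A₂ q + t₂) '' fccStacking 1 (Real.sqrt (2 / 3)) ∧
      h + R₀ ≤ p 2 ∧ p 2 ≤ h + 2 * R₀ ∧ p 0 ^ 2 + p 1 ^ 2 ≤ ρ ^ 2))
    {u : EuclideanSpace ℝ (Fin 3)} (hu : u ∈ fccSlots)
    (hdown : ⟪A₂ u, EuclideanSpace.single (2 : Fin 3) (1 : ℝ)⟫_ℝ ≤ 0)
    {ε : ℝ} (hε : ε = 1 ∨ ε = -1) (i j : ℤ)
    (hAu : A₂ u = L (ε • ((i : ℝ) • triangularVec₁ (1 : ℝ) + (j : ℝ) • triangularVec₂ 1))) :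
    2 / 3 * Real.sqrt 2 * |⟪A₂ u, EuclideanSpace.single (2 : Fin 3) (1 : ℝ)⟫_ℝ| * Real.pi * ρ ^ 2 -
        (12 * Real.sqrt 2 * Real.pi + 120 * R₀) * ρ ≤
      ((X.filter fun e => e ∈ (fun q => A₂ q + t₂) '' fccStacking 1 (Real.sqrt (2 / 3)) ∧
        e ∉ (fun q => A₁ q + t₁) '' fccStacking 1 (Real.sqrt (2 / 3)) ∧
        e + A₂ u ∉ X ∧ e - A₂ u ∈ X ∧ -R₀ - 2 ≤ e 2 ∧ e 2 ≤ h + R₀ + 2).card : ℝ) := by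
  set e₃ : EuclideanSpace ℝ (Fin 3) := EuclideanSpace.single (2 : Fin 3) (1 : ℝ) with he₃
  set Λ₁ := (fun q => A₁ q + t₁) '' fccStacking 1 (Real.sqrt (2 / 3)) with hΛ₁
  set Λ₂ := (fun q => A₂ q + t₂) '' fccStacking 1 (Real.sqrt (2 / 3)) with hΛ₂
  set d : EuclideanSpace ℝ (Fin 3) := A₂ u with hd
  have hρ2 : (2 : ℝ) ≤ ρ := by linarith
  have huΛ : u ∈ fccStacking 1 (Real.sqrt (2 / 3)) := mem_fcc_of_mem_fccSlots hu
  have hd1 : ‖d‖ = 1 := by rw [hd, LinearIsometryEquiv.norm_map, norm_eq_one_of_mem_fccSlots hu]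
  have hd2 : d 2 = ⟪A₂ u, e₃⟫_ℝ := apply_two_eq_inner_e₃ _
  have hd2ge : -1 ≤ d 2 := by
    have := abs_inner_slot_le_one A₂ hu
    rw [hd2]; linarith [neg_abs_le ⟪A₂ u, e₃⟫_ℝ]
  have hd2np : d 2 ≤ 0 := by rw [hd2]; exact hdown
  -- the thinned filling
  set X' : Finset (EuclideanSpace ℝ (Fin 3)) := X.filter fun x => x - d ∈ X ∨ x ∈ P₁ ∨ x ∈ P₂ with hX'
  have hX'X : X' ⊆ X := filter_subset _ _
  have hX'sep : ∀ p ∈ X', ∀ q ∈ X', p ≠ q → 1 ≤ dist p q :=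
    fun p hp q hq hpq => hX p (hX'X hp) q (hX'X hq) hpq
  have hcell' : ∀ p ∈ X', -(2 * R₀) ≤ p 2 ∧ p 2 ≤ h + 2 * R₀ ∧ p 0 ^ 2 + p 1 ^ 2 ≤ ρ ^ 2 :=
    fun p hp => hcell p (hX'X hp)
  have hP₁X' : P₁ ⊆ X' := fun p hp => mem_filter.2 ⟨hP₁X hp, Or.inr (Or.inl hp)⟩
  have hP₂X' : P₂ ⊆ X' := fun p hp => mem_filter.2 ⟨hP₂X hp, Or.inr (Or.inr hp)⟩
  have hbase := card_inPlane_runEnds_top_ge_coaxial A₁ t₁ A₂ t₂ L s₁ s₂ hσ hσ' hsub₁ hsub₂ hne X' P₁ P₂ R₀ h ρ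
    hR₀ hρ hX'sep hcell' hP₁X' hP₂X' hP₁ hP₂ hu hdown hε i j hAu
  -- ends of the thinned filling are ends of `X` with predecessor, up to the upper rim shell
  set ENDS := X.filter fun e => e ∈ Λ₂ ∧ e ∉ Λ₁ ∧ e + d ∉ X ∧ e - d ∈ X ∧ -R₀ - 2 ≤ e 2 ∧ e 2 ≤ h + R₀ + 2
    with hENDS
  set RIM := X.filter fun x => h + R₀ ≤ x 2 ∧ x 2 ≤ h + 2 * R₀ ∧ (ρ - 1) ^ 2 < x 0 ^ 2 + x 1 ^ 2 ∧
    x 0 ^ 2 + x 1 ^ 2 ≤ ρ ^ 2 with hRIM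
  have hsplit : (X'.filter fun e => e ∈ Λ₂ ∧ e ∉ Λ₁ ∧ e + d ∉ X' ∧ -R₀ - 2 ≤ e 2 ∧ e 2 ≤ h + R₀ + 2) ⊆
      ENDS ∪ RIM := by
    intro e he
    rw [mem_filter] at he
    obtain ⟨heX', heΛ₂, heΛ₁, hed, hlo, hhi⟩ := he
    have heX : e ∈ X := hX'X heX'
    have hedX : e + d ∉ X := by
      intro h'
      exact hed (mem_filter.2 ⟨h', Or.inl (by rw [add_sub_cancel_right]; exact heX)⟩)
    rcases (mem_filter.1 heX').2 with hpred | heP₁ | heP₂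
    · exact mem_union_left _ (mem_filter.2 ⟨heX, heΛ₂, heΛ₁, hedX, hpred, hlo, hhi⟩)
    · exact absurd ((hP₁ e).1 heP₁).1 heΛ₁
    · -- a sample ball: its predecessor is a sample ball unless `e` is on the rim
      obtain ⟨-, he1, he2, helat⟩ := (hP₂ e).1 heP₂
      by_cases hr : e 0 ^ 2 + e 1 ^ 2 ≤ (ρ - 1) ^ 2
      · refine mem_union_left _ (mem_filter.2 ⟨heX, heΛ₂, heΛ₁, hedX, ?_, hlo, hhi⟩)
        have hlat' : (e - d) 0 ^ 2 + (e - d) 1 ^ 2 ≤ ρ ^ 2 := by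
          have := lateral_sq_le_of_dist_le_one (y := e - d) (q := e) (r := ρ - 1) (by linarith) hr
            (by rw [dist_eq_norm, sub_sub_cancel_left, norm_neg, hd1])
          rwa [sub_add_cancel] at this
        have h2' : (e - d) 2 = e 2 - d 2 := by simp
        have hmem : e - d ∈ Λ₂ := movedFcc_sub_site_mem A₂ t₂ heΛ₂ huΛ
        exact hP₂X ((hP₂ _).2 ⟨hmem, by rw [h2']; linarith, by rw [h2']; linarith, hlat'⟩)
      · push Not at hr
        exact mem_union_right _ (mem_filter.2 ⟨heX, he1, he2, hr, helat⟩)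
  have hRIM_le : (RIM.card : ℝ) ≤ 6 * (R₀ + 2) * (6 * ρ - 3) := by
    have h1 := card_rim_window_le X (h + R₀) (h + 2 * R₀) ρ (by linarith) hρ2 hX RIM
      (filter_subset _ _) (fun p hp => (mem_filter.1 hp).2)
    have e : h + 2 * R₀ - (h + R₀) + 2 = R₀ + 2 := by ring
    rwa [e] at h1
  have hcard : (X'.filter fun e => e ∈ Λ₂ ∧ e ∉ Λ₁ ∧ e + d ∉ X' ∧ -R₀ - 2 ≤ e 2 ∧ e 2 ≤ h + R₀ + 2).card ≤
      ENDS.card + RIM.card := (card_le_card hsplit).trans (card_union_le _ _)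
  have hcard' : (((X'.filter fun e => e ∈ Λ₂ ∧ e ∉ Λ₁ ∧ e + d ∉ X' ∧ -R₀ - 2 ≤ e 2 ∧
      e 2 ≤ h + R₀ + 2).card : ℕ) : ℝ) ≤ (ENDS.card : ℝ) + (RIM.card : ℝ) := by exact_mod_cast hcard
  have hρ0 : (0 : ℝ) ≤ ρ := by linarith
  have hrim : 6 * (R₀ + 2) * (6 * ρ - 3) ≤ 48 * R₀ * ρ := by nlinarith
  have e120 : (12 * Real.sqrt 2 * Real.pi + 120 * R₀) * ρ =
      (12 * Real.sqrt 2 * Real.pi + 72 * R₀) * ρ + 48 * R₀ * ρ := by ring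
  rw [e120]
  linarith

end Summit.Ventures.Crystal3D.Theorems

end
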